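import Literature.NumberTheory.GaloisRepresentations.CubicReciprocityRationalPrime
import Mathlib.NumberTheory.NumberField.Cyclotomic.Three
import Mathlib.NumberTheory.LegendreSymbol.QuadraticChar.Basic
import HarnessLib

/-!
# `J(χ_𝔭, χ_𝔭)` is primary: `J(χ_𝔭, χ_𝔭) ≡ −1 (mod 3)` and `J(χ_𝔭, χ_𝔭) = −ϖ_𝔭` in `ℤ[ω]`;
# `J(χ, ρ) = χ(4) J(χ, χ)`

Topic `NumberTheory/GaloisRepresentations` (continuing `CubicResidueSymbol` / `CubicReciprocityRationalPrime`,
whose module docstring lists as "Not here: … `J(χ_π, χ_π) = π` on the nose"); namespace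
`Literature.NumberTheory.GaloisRepresentations`. Everything is PROVED; no definition, no named fact.

* `jacobiSum_quadraticChar_eq_mul_jacobiSum_self` — **`J(χ, ρ) = χ(4) J(χ, χ)`** for every non-trivial
  multiplicative character `χ` (values in a domain) and the quadratic character `ρ` of a finite field
  of odd characteristic: `J(χ, χ) = Σ_t χ(t − t²) = Σ_u χ(u)(1 + ρ(1 − 4u))` (complete the square,
  `card_filter_sub_sq_eq`, Mathlib's `quadraticChar_card_sqrts`) and `u = v/4` (Ireland–Rosen Ch. 8 §3;
  the link between the count of `y² = x³ + D` through `J(χ, ρ)` in Ch. 18 §3 and `J(χ_π, χ_π)`).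
* `cubicJacobiSum_add_one_mem_span_three` — **`J(χ_𝔭, χ_𝔭) ≡ −1 (mod 3)`** at every finite place
  `𝔭 ∤ 3` of a number field containing `ζ₃` (Ireland–Rosen Prop. 8.3.4), by an elementary `λ`-adic
  count (`λ = 1 − ζ`, `ζ^e ≡ 1 − eλ (mod λ² = (3))`, `3 ∣ Σ e_t` from
  `∏_t χ(t)χ(1−t) = χ(−1)² = 1` — Wilson — and `3 ∣ N𝔭 − 1`), instead of the printed `g(χ)³ = pJ`.
* For `K = ℚ(ω)` (`IsCyclotomicExtension {3} ℚ K`): the two hypotheses of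
  `PrimaryGeneratorHeckeCharacter` for the modulus `𝔣 = (3)` — `units_eq_one_of_sub_one_mem_span_three`
  (`hinj`: a unit `≡ 1 (mod 3)` is `1`; Kummer's lemma for `p = 3`, Mathlib's
  `IsCyclotomicExtension.Rat.Three.eq_one_or_neg_one_of_unit_of_congruent`) and
  `exists_units_mul_sub_one_mem_span_three` (`hsurj`: every integer prime to `3` has a unit multiple
  `≡ 1 (mod 3)`; Ireland–Rosen Prop. 9.3.5 "primary") — and **`cubicJacobiSum_eq_neg_of_span_eq`:
  `J(χ_𝔭, χ_𝔭) = −ϖ_𝔭`** for THE generator `ϖ_𝔭 ≡ 1 (mod 3)` of `𝔭` (`exists_span_eq_and_sub_one_mem_span_three`,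
  `eq_of_span_eq_of_sub_one_mem_span_three`; this is `primaryGen` of `PrimaryGeneratorHeckeCharacter` for
  `𝔣 = (3)`, not imported here)
  (Ireland–Rosen Ch. 9 §4 Lemma 1, whose primary `π ≡ 2 (mod 3)` is `−ϖ_𝔭`), from `(J) = 𝔭`
  (`span_cubicJacobiSum_eq`) and the congruence.

These are the inputs "on the nose" for the law of cubic reciprocity between primes of `ℤ[ω]` and for
the explicit Frobenius trace of `y² = x³ + D` (Ireland–Rosen Ch. 18 §3 Thm. 4), hence for the
Grössencharacter of the CM elliptic curves with `j = 0`.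

## References

* K. Ireland, M. Rosen, *A Classical Introduction to Modern Number Theory*, 2nd ed., GTM 84 (1990),
  Ch. 8 §3 (Prop. 8.3.4, Exercises), Ch. 9 §3 Prop. 9.3.5, Ch. 9 §4 Lemma 1, Ch. 18 §3 Thm. 4.
  [cite: IrelandRosen1990, Ch. 9 §4 Lemma 1]

## Mathlib / tree search

Tree: `cubicResidueSymbol`, `cubicResidueChar`, `cubicResidueSymbol_spec/_mul/_one`,
`one_sub_sq_eq_neg_three_mul`, `three_mem_span_one_sub`, `three_dvd_residueCard_sub_one`,
`sq_add_self_add_one_eq_zero` (`CubicResidueSymbol`); `cubicJacobiSum`, `cubicJacobiSum_eq`,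
`span_cubicJacobiSum_eq` (`CubicReciprocityRationalPrime`); the pattern of `primarize`/`primaryGen`,
`eq_of_span_eq_of_sub_one_mem` (`PrimaryGeneratorHeckeCharacter`, not imported: its import closure is heavy);
`HeightOneSpectrum.residueCard_eq_card_quotient`. Mathlib: `jacobiSum`, `quadraticChar_card_sqrts`,
`MulChar.sum_eq_zero_of_ne_one`, `FiniteField.prod_univ_units_id_eq_neg_one`, `unitsEquivNeZero`,
`IsPrimitiveRoot.eq_pow_of_pow_eq_one`, `IsPrimitiveRoot.pow_eq_one_iff_dvd`,
`IsCyclotomicExtension.Rat.Three.eq_one_or_neg_one_of_unit_of_congruent`,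
`IsCyclotomicExtension.Rat.Three.lambda_dvd_or_dvd_sub_one_or_dvd_add_one`,
`IsPrimitiveRoot.zeta_sub_one_prime'`. The announced `EisensteinPrimaryHeckeCharacter` (docstring of
`PrimaryGeneratorHeckeCharacter`) is not in the tree (`lean search 'hsurj|EisensteinPrimary'`).
-/

noncomputable section

open NumberField IsDedekindDomain Finset

namespace Literature.NumberTheory.GaloisRepresentations

/-! ### `J(χ, ρ) = χ(4) J(χ, χ)` over a finite field of odd characteristic -/

section FiniteField

variable {F : Type*} [Field F] [Fintype F] [DecidableEq F] {R : Type*} [CommRing R] [IsDomain R]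

/-- `#{t : t − t² = u} = #{s : s² = 1 − 4u}` in odd characteristic (`s = 1 − 2t`). [folklore] -/
theorem card_filter_sub_sq_eq (hF : ringChar F ≠ 2) (u : F) :
    #{t : F | t - t ^ 2 = u} = #{s : F | s ^ 2 = 1 - 4 * u} := by
  have h2 : (2 : F) ≠ 0 := Ring.two_ne_zero hF
  refine Finset.card_bij (fun t _ ↦ 1 - 2 * t) (fun t ht ↦ ?_) (fun t₁ _ t₂ _ h ↦ ?_) (fun s hs ↦ ?_)
  · simp only [Finset.mem_filter, Finset.mem_univ, true_and] at ht ⊢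
    rw [← ht]; ring
  · have h' : (2 : F) * t₁ = 2 * t₂ := by linear_combination -h
    exact mul_left_cancel₀ h2 h'
  · simp only [Finset.mem_filter, Finset.mem_univ, true_and] at hs ⊢
    refine ⟨(1 - s) / 2, ?_, ?_⟩
    · field_simp
      linear_combination -hs
    · field_simp
      ring

/-- `J(χ, χ) = Σ_u χ(u) ρ(1 − 4u)` for a non-trivial multiplicative character `χ` and the quadratic
character `ρ` of a finite field of odd characteristic: `J(χ, χ) = Σ_t χ(t − t²)` and
`#{t : t − t² = u} = 1 + ρ(1 − 4u)`, `Σ_u χ(u) = 0`. [cite: IrelandRosen1990, Ch. 8 §3] -/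
theorem jacobiSum_self_eq_sum_mul_quadraticChar (hF : ringChar F ≠ 2) {χ : MulChar F R} (hχ : χ ≠ 1) :
    jacobiSum χ χ = ∑ u : F, χ u * ((quadraticChar F (1 - 4 * u) : ℤ) : R) := by
  have h1 : jacobiSum χ χ = ∑ t : F, χ (t - t ^ 2) := by
    unfold jacobiSum
    refine Finset.sum_congr rfl fun t _ ↦ ?_
    rw [← map_mul]; congr 1; ring
  have h2 : ∑ t : F, χ (t - t ^ 2) =
      ∑ u : F, (χ u * ((quadraticChar F (1 - 4 * u) : ℤ) : R) + χ u) := by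
    rw [← Finset.sum_fiberwise_of_maps_to' (s := Finset.univ) (t := Finset.univ)
      (g := fun t : F ↦ t - t ^ 2) (fun _ _ ↦ Finset.mem_univ _) (fun u ↦ χ u)]
    refine Finset.sum_congr rfl fun u _ ↦ ?_
    rw [Finset.sum_const, nsmul_eq_mul]
    have hcard : ((#{t : F | t - t ^ 2 = u} : ℕ) : ℤ) = quadraticChar F (1 - 4 * u) + 1 := by
      rw [card_filter_sub_sq_eq hF u]
      have h := quadraticChar_card_sqrts hF (1 - 4 * u)
      rwa [Set.toFinset_setOf] at h
    have hcardR : ((#{t : F | t - t ^ 2 = u} : ℕ) : R) =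
        ((quadraticChar F (1 - 4 * u) : ℤ) : R) + 1 := by
      have := congrArg (Int.cast : ℤ → R) hcard
      push_cast at this
      exact this
    rw [hcardR]
    ring
  rw [h1, h2, Finset.sum_add_distrib, MulChar.sum_eq_zero_of_ne_one hχ, add_zero]

/-- **`J(χ, ρ) = χ(4) J(χ, χ)`** for a non-trivial multiplicative character `χ` and the quadratic
character `ρ` of a finite field of odd characteristic (substitute `u = v/4` in
`J(χ, χ) = Σ_u χ(u) ρ(1 − 4u)`). This is the relation `J(χ, ρ) = χ(2)² J(χ, χ)` of Ireland–Rosen,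
Ch. 8 §3, Exercise; for a cubic `χ` it ties the count of `y² = x³ + D` (through `J(χ, ρ)`,
Ch. 18 §3) to the primary prime `J(χ_π, χ_π) = π` (Ch. 9 §4 Lemma 1). [cite: IrelandRosen1990, Ch. 8 §3 and Ch. 18 §3 Thm. 4] -/
theorem jacobiSum_quadraticChar_eq_mul_jacobiSum_self (hF : ringChar F ≠ 2) {χ : MulChar F R}
    (hχ : χ ≠ 1) :
    jacobiSum χ ((quadraticChar F).ringHomComp (Int.castRingHom R)) = χ 4 * jacobiSum χ χ := by
  have h2 : (2 : F) ≠ 0 := Ring.two_ne_zero hF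
  have h4 : (4 : F) ≠ 0 := by
    rw [show (4 : F) = 2 * 2 by norm_num]; exact mul_ne_zero h2 h2
  rw [jacobiSum_self_eq_sum_mul_quadraticChar hF hχ, Finset.mul_sum]
  unfold jacobiSum
  refine (Fintype.sum_equiv (Equiv.mulLeft₀ (4 : F) h4) _ _ fun u ↦ ?_).symm
  simp only [Equiv.mulLeft₀_apply, MulChar.ringHomComp_apply, eq_intCast, map_mul]
  ring

end FiniteField

/-! ### `J(χ_𝔭, χ_𝔭) ≡ −1 (mod 3)` -/

section Congruence

variable {K : Type*} [Field K] [NumberField K]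
variable {ζ : 𝓞 K} (hζ : IsPrimitiveRoot ζ 3)

omit [NumberField K] in
/-- `ζ^i ≡ 1 − i(1 − ζ) (mod (1 − ζ)²)`. [folklore] -/
theorem pow_sub_one_add_mul_mem_span_sq (i : ℕ) :
    ζ ^ i - 1 + (i : 𝓞 K) * (1 - ζ) ∈ Ideal.span {(1 - ζ) ^ 2} := by
  induction i with
  | zero => simp
  | succ i ih =>
    have e : ζ ^ (i + 1) - 1 + ((i + 1 : ℕ) : 𝓞 K) * (1 - ζ) =
        ζ * (ζ ^ i - 1 + (i : 𝓞 K) * (1 - ζ)) + (i : 𝓞 K) * (1 - ζ) ^ 2 := by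
      push_cast; ring
    rw [e]
    exact Ideal.add_mem _ (Ideal.mul_mem_left _ _ ih)
      (Ideal.mul_mem_left _ _ (Ideal.subset_span rfl))

include hζ in
omit [NumberField K] in
/-- `(1 − ζ)² = −3ζ ∈ (3)`. [folklore] -/
theorem span_one_sub_sq_le_span_three : Ideal.span {(1 - ζ) ^ 2} ≤ Ideal.span {(3 : 𝓞 K)} := by
  rw [Ideal.span_singleton_le_iff_mem, one_sub_sq_eq_neg_three_mul hζ, Ideal.mem_span_singleton]
  exact ⟨-ζ, by ring⟩

include hζ in
/-- A cubic residue character takes the value `1` at `−1` (`χ(−1)² = χ(1) = 1 = χ(−1)³`). [folklore] -/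
theorem cubicResidueSymbol_neg_one {𝔭 : HeightOneSpectrum (𝓞 K)} (h3 : (3 : 𝓞 K) ∉ 𝔭.asIdeal) :
    cubicResidueSymbol 𝔭 (-1 : 𝓞 K ⧸ 𝔭.asIdeal) = 1 := by
  letI := Ideal.Quotient.field 𝔭.asIdeal
  have h3' := (cubicResidueSymbol_spec hζ h3 (neg_ne_zero.mpr (one_ne_zero' (𝓞 K ⧸ 𝔭.asIdeal)))).1
  have h2 : cubicResidueSymbol 𝔭 (-1 : 𝓞 K ⧸ 𝔭.asIdeal) ^ 2 = 1 := by
    rw [sq, ← cubicResidueSymbol_mul hζ, neg_one_mul, neg_neg, cubicResidueSymbol_one hζ h3]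
  calc cubicResidueSymbol 𝔭 (-1 : 𝓞 K ⧸ 𝔭.asIdeal)
      = cubicResidueSymbol 𝔭 (-1 : 𝓞 K ⧸ 𝔭.asIdeal) * cubicResidueSymbol 𝔭 (-1 : 𝓞 K ⧸ 𝔭.asIdeal) ^ 2 := by
        rw [h2, mul_one]
    _ = cubicResidueSymbol 𝔭 (-1 : 𝓞 K ⧸ 𝔭.asIdeal) ^ 3 := by ring
    _ = 1 := h3'

include hζ in
/-- `∏_{t ≠ 0} χ_𝔭(t) = χ_𝔭(−1) = 1` (Wilson). [folklore] -/
theorem prod_cubicResidueSymbol_ne_zero {𝔭 : HeightOneSpectrum (𝓞 K)} (h3 : (3 : 𝓞 K) ∉ 𝔭.asIdeal)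
    [Fintype (𝓞 K ⧸ 𝔭.asIdeal)] [DecidableEq (𝓞 K ⧸ 𝔭.asIdeal)] :
    ∏ t ∈ (Finset.univ : Finset (𝓞 K ⧸ 𝔭.asIdeal)).filter (· ≠ 0), cubicResidueSymbol 𝔭 t = 1 := by
  letI := Ideal.Quotient.field 𝔭.asIdeal
  set χ := cubicResidueChar hζ 𝔭 h3
  have h1 : ∏ t ∈ (Finset.univ : Finset (𝓞 K ⧸ 𝔭.asIdeal)).filter (· ≠ 0), cubicResidueSymbol 𝔭 t =
      ∏ u : (𝓞 K ⧸ 𝔭.asIdeal)ˣ, χ (u : 𝓞 K ⧸ 𝔭.asIdeal) := by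
    rw [Finset.prod_subtype ((Finset.univ : Finset (𝓞 K ⧸ 𝔭.asIdeal)).filter (· ≠ 0))
      (p := fun t : 𝓞 K ⧸ 𝔭.asIdeal ↦ t ≠ 0) (fun t ↦ by simp)]
    refine (Fintype.prod_equiv unitsEquivNeZero _ _ fun u ↦ ?_).symm
    rfl
  rw [h1, ← map_prod, ← Units.coe_prod, FiniteField.prod_univ_units_id_eq_neg_one, Units.val_neg,
    Units.val_one]
  exact cubicResidueSymbol_neg_one hζ h3

include hζ in
/-- **`J(χ_𝔭, χ_𝔭) ≡ −1 (mod 3)`** for the cubic residue character at a finite place `𝔭 ∤ 3` of a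
number field containing the cube roots of unity (Ireland–Rosen Prop. 8.3.4: `J(χ, χ) = a + bω` with
`a ≡ −1`, `b ≡ 0 (mod 3)`; equivalently `J(χ_π, χ_π)` is primary, the key to `J(χ_π, χ_π) = π`,
Ch. 9 §4 Lemma 1). Elementary proof: the `q − 2` non-zero terms `χ(t)χ(1−t) = ζ^{e_t}` are cube
roots of unity, `ζ^e ≡ 1 − e(1 − ζ) (mod (1−ζ)² = (3))`, and `3 ∣ Σ e_t` because
`∏_t χ(t)χ(1−t) = (∏_{t≠0} χ(t))² = χ(−1)² = 1`; finally `3 ∣ q − 1`.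
[cite: IrelandRosen1990, Ch. 8 §3 Prop. 8.3.4 and Ch. 9 §4 Lemma 1] -/
theorem cubicJacobiSum_add_one_mem_span_three (𝔭 : HeightOneSpectrum (𝓞 K))
    (h3 : (3 : 𝓞 K) ∉ 𝔭.asIdeal) :
    cubicJacobiSum hζ 𝔭 h3 + 1 ∈ Ideal.span {(3 : 𝓞 K)} := by
  classical
  letI := Ideal.Quotient.field 𝔭.asIdeal
  letI := Fintype.ofFinite (𝓞 K ⧸ 𝔭.asIdeal)
  set χ := cubicResidueChar hζ 𝔭 h3 with hχdef
  rw [cubicJacobiSum_eq hζ 𝔭 h3]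
  -- the index set `S = F ∖ {0, 1}` and the terms `x t = χ(t)χ(1−t)`
  set S : Finset (𝓞 K ⧸ 𝔭.asIdeal) := Finset.univ \ {0, 1} with hSdef
  have hmemS : ∀ t, t ∈ S ↔ t ≠ 0 ∧ t ≠ 1 := fun t ↦ by
    simp [hSdef, not_or]
  set x : 𝓞 K ⧸ 𝔭.asIdeal → 𝓞 K := fun t ↦ χ t * χ (1 - t) with hxdef
  have hJ : jacobiSum χ χ = ∑ t ∈ S, x t := by
    unfold jacobiSum
    symm
    refine Finset.sum_subset (Finset.subset_univ _) fun t _ ht ↦ ?_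
    rw [hmemS, not_and_or, not_not, not_not] at ht
    rcases ht with rfl | rfl
    · simp [hxdef, MulChar.map_zero]
    · simp [hxdef, MulChar.map_zero]
  -- each `x t`, `t ∈ S`, is a cube root of unity
  have hx3 : ∀ t ∈ S, x t ^ 3 = 1 := by
    intro t ht
    rw [hmemS] at ht
    have h1 := (cubicResidueSymbol_spec hζ h3 ht.1).1
    have h2 := (cubicResidueSymbol_spec hζ h3 (sub_ne_zero.mpr (Ne.symm ht.2))).1
    show (cubicResidueSymbol 𝔭 t * cubicResidueSymbol 𝔭 (1 - t)) ^ 3 = 1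
    rw [mul_pow, h1, h2, one_mul]
  -- exponents `e t < 3` with `ζ^{e t} = x t`
  have hex : ∀ t, ∃ i : ℕ, i < 3 ∧ (t ∈ S → ζ ^ i = x t) := by
    intro t
    by_cases ht : t ∈ S
    · obtain ⟨i, hi, h⟩ := hζ.eq_pow_of_pow_eq_one (hx3 t ht)
      exact ⟨i, hi, fun _ ↦ h⟩
    · exact ⟨0, by norm_num, fun h ↦ (ht h).elim⟩
  choose e _ he using hex
  -- (1) the `λ`-adic expansion of the terms
  have hA : ∑ t ∈ S, (ζ ^ e t - 1 + (e t : 𝓞 K) * (1 - ζ)) ∈ Ideal.span {(3 : 𝓞 K)} :=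
    Ideal.sum_mem _ fun t _ ↦ span_one_sub_sq_le_span_three hζ (pow_sub_one_add_mul_mem_span_sq (e t))
  -- (2) `3 ∣ Σ e t`, from `∏ x t = 1`
  have hprodχ : ∏ t ∈ S, χ t = 1 := by
    have h0 : ∏ t ∈ (Finset.univ : Finset (𝓞 K ⧸ 𝔭.asIdeal)).filter (· ≠ 0), χ t =
        χ 1 * ∏ t ∈ S, χ t := by
      rw [← Finset.mul_prod_erase _ _ (show (1 : 𝓞 K ⧸ 𝔭.asIdeal) ∈
        (Finset.univ : Finset (𝓞 K ⧸ 𝔭.asIdeal)).filter (· ≠ 0) by simp)]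
      congr 1
      refine Finset.prod_congr ?_ fun _ _ ↦ rfl
      ext t
      simp [hmemS, and_comm]
    have h := prod_cubicResidueSymbol_ne_zero hζ h3 (𝔭 := 𝔭)
    simp only [show ∀ t, cubicResidueSymbol 𝔭 t = χ t from fun t ↦ rfl] at h
    rw [h0, map_one, one_mul] at h
    exact h
  have hprod : ∏ t ∈ S, x t = 1 := by
    have hre : ∏ t ∈ S, χ (1 - t) = ∏ t ∈ S, χ t := by
      refine Finset.prod_equiv (Equiv.subLeft (1 : 𝓞 K ⧸ 𝔭.asIdeal)) (fun t ↦ ?_) (fun t _ ↦ ?_)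
      · simp only [hmemS, Equiv.subLeft_apply]
        constructor
        · rintro ⟨h0, h1⟩; exact ⟨sub_ne_zero.mpr (Ne.symm h1), fun h ↦ h0 (by linear_combination -h)⟩
        · rintro ⟨h0, h1⟩; exact ⟨fun h ↦ h1 (by rw [h, sub_zero]), fun h ↦ h0 (by linear_combination -h)⟩
      · simp
    show ∏ t ∈ S, χ t * χ (1 - t) = 1
    rw [Finset.prod_mul_distrib, hre, hprodχ, one_mul]
  have hsum3 : 3 ∣ ∑ t ∈ S, e t := by
    rw [← hζ.pow_eq_one_iff_dvd, ← Finset.prod_pow_eq_pow_sum]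
    rw [← hprod]
    exact Finset.prod_congr rfl fun t ht ↦ he t ht
  obtain ⟨k, hk⟩ := hsum3
  -- (3) `#S + 1 = q − 1` is a multiple of `3`
  have hcardS : #S + 2 = Fintype.card (𝓞 K ⧸ 𝔭.asIdeal) := by
    rw [hSdef, ← Finset.card_univ, ← Finset.card_pair (zero_ne_one' (𝓞 K ⧸ 𝔭.asIdeal)),
      Finset.card_sdiff_add_card_eq_card (Finset.subset_univ _)]
  have hq3 : 3 ∣ Fintype.card (𝓞 K ⧸ 𝔭.asIdeal) - 1 := by
    have h := three_dvd_residueCard_sub_one hζ h3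
    rwa [HeightOneSpectrum.residueCard_eq_card_quotient, Nat.card_eq_fintype_card] at h
  obtain ⟨m, hm⟩ := hq3
  have hS1 : ((#S : ℕ) : 𝓞 K) + 1 = 3 * (m : 𝓞 K) := by
    have : #S + 1 = 3 * m := by omega
    exact_mod_cast this
  -- assembly
  have key : ∑ t ∈ S, x t + 1 =
      ∑ t ∈ S, (ζ ^ e t - 1 + (e t : 𝓞 K) * (1 - ζ)) + (((#S : ℕ) : 𝓞 K) + 1)
        - (1 - ζ) * ((∑ t ∈ S, e t : ℕ) : 𝓞 K) := by
    rw [Finset.sum_add_distrib, Finset.sum_sub_distrib, Finset.sum_const, nsmul_eq_mul, mul_one,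
      Nat.cast_sum, Finset.mul_sum]
    have hxe : ∑ t ∈ S, x t = ∑ t ∈ S, ζ ^ e t := Finset.sum_congr rfl fun t ht ↦ (he t ht).symm
    rw [hxe]
    have hcomm : ∑ t ∈ S, (e t : 𝓞 K) * (1 - ζ) = ∑ t ∈ S, (1 - ζ) * (e t : 𝓞 K) :=
      Finset.sum_congr rfl fun _ _ ↦ mul_comm _ _
    rw [hcomm]
    ring
  rw [hJ, key, hS1, hk, Nat.cast_mul, Nat.cast_ofNat]
  refine Ideal.sub_mem _ (Ideal.add_mem _ hA (Ideal.mul_mem_right _ _ (Ideal.subset_span rfl))) ?_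
  rw [show (1 - ζ) * (3 * (k : 𝓞 K)) = 3 * ((1 - ζ) * k) by ring]
  exact Ideal.mul_mem_right _ _ (Ideal.subset_span rfl)

end Congruence

/-! ### The Eisenstein integers: units versus residues mod `3`, and `J(χ_𝔭, χ_𝔭) = −ϖ_𝔭` -/

section Eisenstein

variable {K : Type*} [Field K] {ζ : 𝓞 K} (hζ : IsPrimitiveRoot ζ 3)

include hζ in
/-- The field element underlying `ζ` is a primitive cube root of unity. [folklore] -/
theorem isPrimitiveRoot_coe_three : IsPrimitiveRoot ((ζ : 𝓞 K) : K) 3 :=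
  hζ.map_of_injective (FaithfulSMul.algebraMap_injective (𝓞 K) K)

/-- `toInteger` of the coercion of `ζ` is `ζ` (for any proof of primitivity). [folklore] -/
theorem toInteger_coe_eq (h : IsPrimitiveRoot ((ζ : 𝓞 K) : K) 3) : h.toInteger = ζ := by
  ext; rfl

variable [NumberField K] [IsCyclotomicExtension {3} ℚ K]

include hζ in
/-- `1 − ζ` is prime in `𝓞 K` (Mathlib's `zeta_sub_one_prime'`, up to sign). [folklore] -/
theorem prime_one_sub : Prime (1 - ζ) := by
  have hp := (isPrimitiveRoot_coe_three hζ).zeta_sub_one_prime'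
  rw [toInteger_coe_eq] at hp
  rw [show (1 - ζ) = -(ζ - 1) by ring]
  exact hp.neg

include hζ in
/-- `3` is not a unit of `𝓞 K` (`1 − ζ` is a prime dividing it). [folklore] -/
theorem not_isUnit_three : ¬ IsUnit (3 : 𝓞 K) := by
  intro h
  have hl : IsUnit ((1 - ζ) ^ 2) := by
    rw [one_sub_sq_eq_neg_three_mul hζ, neg_mul, IsUnit.neg_iff]
    exact h.mul (hζ.isUnit (by norm_num))
  rw [isUnit_pow_iff two_ne_zero] at hl
  exact (prime_one_sub hζ).not_unit hl

include hζ in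
/-- **Injectivity**: a unit of `ℤ[ω]` congruent to `1 mod 3` is `1` (Kummer's lemma for `p = 3`,
Mathlib's `eq_one_or_neg_one_of_unit_of_congruent`, and `−1 ≢ 1`). This is hypothesis `hinj` of
`PrimaryGeneratorHeckeCharacter` for `𝔣 = (3)`. [cite: IrelandRosen1990, Ch. 9 §3 Prop. 9.3.5] -/
theorem units_eq_one_of_sub_one_mem_span_three (u : (𝓞 K)ˣ)
    (hu : (u : 𝓞 K) - 1 ∈ Ideal.span {(3 : 𝓞 K)}) : u = 1 := by
  have hζ' := isPrimitiveRoot_coe_three hζ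
  rw [Ideal.mem_span_singleton] at hu
  obtain ⟨c, hc⟩ := hu
  have hcong : ∃ n : ℤ, (hζ'.toInteger - 1) ^ 2 ∣ ((u : 𝓞 K) - n) := by
    refine ⟨1, ?_⟩
    rw [toInteger_coe_eq, show (ζ - 1) ^ 2 = (1 - ζ) ^ 2 by ring,
      one_sub_sq_eq_neg_three_mul hζ]
    refine ⟨-(ζ ^ 2 * c), ?_⟩
    rw [Int.cast_one, hc]
    have h3 : ζ ^ 3 = 1 := hζ.pow_eq_one
    linear_combination -(3 * c) * h3
  rcases IsCyclotomicExtension.Rat.Three.eq_one_or_neg_one_of_unit_of_congruent hζ' u hcong with h | h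
  · exact h
  · exfalso
    rw [h, Units.val_neg, Units.val_one] at hc
    have h32 : (3 : 𝓞 K) ∣ 1 := ⟨c + 1, by linear_combination hc⟩
    exact not_isUnit_three hζ (isUnit_of_dvd_one h32)

include hζ in
/-- `(1 − ζ)` does not divide an `x` prime to `3`. [folklore] -/
theorem not_one_sub_dvd_of_isCoprime {x : 𝓞 K}
    (hx : IsCoprime (Ideal.span {x}) (Ideal.span {(3 : 𝓞 K)})) : ¬ (1 - ζ) ∣ x := by
  intro hdvd
  have h1 : Ideal.span {x} ≤ Ideal.span {1 - ζ} := Ideal.span_singleton_le_span_singleton.mpr hdvd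
  have h2 : Ideal.span {(3 : 𝓞 K)} ≤ Ideal.span {1 - ζ} :=
    (Ideal.span_singleton_le_iff_mem _).mpr (three_mem_span_one_sub hζ)
  have htop : Ideal.span {1 - ζ} = ⊤ := top_le_iff.mp ((Ideal.isCoprime_iff_sup_eq.mp hx) ▸ sup_le h1 h2)
  rw [Ideal.span_singleton_eq_top] at htop
  exact (prime_one_sub hζ).not_unit htop

include hζ in
/-- The case `x ≡ 1 (mod 1 − ζ)` of surjectivity: some power of `ζ` multiplies `x` into `1 + (3)`
(`x ≡ 1, 1 + λ ≡ ζ², 1 − λ ≡ ζ (mod λ²)` according as `(x − 1)/λ ≡ 0, 1, −1 (mod λ)`, `λ = 1 − ζ`).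
[folklore] -/
theorem exists_pow_mul_sub_one_mem_of_dvd_sub_one {x : 𝓞 K} (hx : (1 - ζ) ∣ x - 1) :
    ∃ k : ℕ, ζ ^ k * x - 1 ∈ Ideal.span {(3 : 𝓞 K)} := by
  have hζ' := isPrimitiveRoot_coe_three hζ
  have hl : hζ'.toInteger - 1 = -(1 - ζ) := by rw [toInteger_coe_eq]; ring
  obtain ⟨a, ha⟩ := hx
  have h3 : ζ ^ 3 = 1 := hζ.pow_eq_one
  have hζ2 : ζ ^ 2 + ζ + 1 = 0 := sq_add_self_add_one_eq_zero hζ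
  have hsq : (1 - ζ) ^ 2 = -3 * ζ := one_sub_sq_eq_neg_three_mul hζ
  rcases IsCyclotomicExtension.Rat.Three.lambda_dvd_or_dvd_sub_one_or_dvd_add_one hζ' a with
    h | h | h
  · -- `a ≡ 0`: `x ≡ 1 (mod 3)`
    obtain ⟨b, hb⟩ := h
    rw [hl] at hb
    refine ⟨0, ?_⟩
    rw [pow_zero, one_mul, Ideal.mem_span_singleton]
    exact ⟨ζ * b, by linear_combination ha + (1 - ζ) * hb - b * hsq⟩
  · -- `a ≡ 1`: `x = 2 − ζ + 3ζb`, `ζ x − 1 = 3(ζ + ζ² b)`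
    obtain ⟨b, hb⟩ := h
    rw [hl] at hb
    have hxe : x = 2 - ζ + 3 * ζ * b := by linear_combination ha + (1 - ζ) * hb - b * hsq
    refine ⟨1, ?_⟩
    rw [pow_one, Ideal.mem_span_singleton]
    exact ⟨ζ + ζ ^ 2 * b, by linear_combination ζ * hxe - hζ2⟩
  · -- `a ≡ −1`: `x = ζ(1 + 3b)`, `ζ² x − 1 = 3b`
    obtain ⟨b, hb⟩ := h
    rw [hl] at hb
    have hxe : x = ζ + 3 * ζ * b := by linear_combination ha + (1 - ζ) * hb - b * hsq
    refine ⟨2, ?_⟩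
    rw [Ideal.mem_span_singleton]
    exact ⟨b, by linear_combination ζ ^ 2 * hxe + (1 + 3 * b) * h3⟩

include hζ in
/-- **Surjectivity**: every `x ∈ ℤ[ω]` prime to `3` has a unit multiple `≡ 1 (mod 3)` (the units
`±1, ±ω, ±ω²` represent `(ℤ[ω]/3)ˣ`; Ireland–Rosen Prop. 9.3.5, "primary" elements). This is
hypothesis `hsurj` of `PrimaryGeneratorHeckeCharacter` for `𝔣 = (3)`.
[cite: IrelandRosen1990, Ch. 9 §3 Prop. 9.3.5] -/
theorem exists_units_mul_sub_one_mem_span_three (x : 𝓞 K)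
    (hx : IsCoprime (Ideal.span {x}) (Ideal.span {(3 : 𝓞 K)})) :
    ∃ u : (𝓞 K)ˣ, (u : 𝓞 K) * x - 1 ∈ Ideal.span {(3 : 𝓞 K)} := by
  have hζ' := isPrimitiveRoot_coe_three hζ
  have hl : hζ'.toInteger - 1 = -(1 - ζ) := by rw [toInteger_coe_eq]; ring
  have hζu : IsUnit ζ := hζ.isUnit (by norm_num)
  rcases IsCyclotomicExtension.Rat.Three.lambda_dvd_or_dvd_sub_one_or_dvd_add_one hζ' x with
    h | h | h
  · rw [hl, neg_dvd] at h
    exact absurd h (not_one_sub_dvd_of_isCoprime hζ hx)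
  · rw [hl, neg_dvd] at h
    obtain ⟨k, hk⟩ := exists_pow_mul_sub_one_mem_of_dvd_sub_one hζ h
    refine ⟨hζu.unit ^ k, ?_⟩
    rwa [Units.val_pow_eq_pow_val, IsUnit.unit_spec]
  · rw [hl, neg_dvd] at h
    have h' : (1 - ζ) ∣ -x - 1 := by rw [show -x - 1 = -(x + 1) by ring, dvd_neg]; exact h
    obtain ⟨k, hk⟩ := exists_pow_mul_sub_one_mem_of_dvd_sub_one hζ h'
    refine ⟨-(hζu.unit ^ k), ?_⟩
    rw [Units.val_neg, Units.val_pow_eq_pow_val, IsUnit.unit_spec]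
    rwa [show -ζ ^ k * x - 1 = ζ ^ k * -x - 1 by ring]

include hζ in
/-- **Uniqueness of primary generators**: two generators of the same ideal prime to `3`, both
`≡ 1 (mod 3)`, coincide (their ratio is a unit `≡ 1 (mod 3)`). [cite: IrelandRosen1990, Ch. 9 §3 Prop. 9.3.5] -/
theorem eq_of_span_eq_of_sub_one_mem_span_three {x y : 𝓞 K} (hxy : Ideal.span {x} = Ideal.span {y})
    (hx : IsCoprime (Ideal.span {x}) (Ideal.span {(3 : 𝓞 K)}))
    (hx1 : x - 1 ∈ Ideal.span {(3 : 𝓞 K)}) (hy1 : y - 1 ∈ Ideal.span {(3 : 𝓞 K)}) : x = y := by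
  obtain ⟨u, rfl⟩ := Ideal.span_singleton_eq_span_singleton.mp hxy
  -- `x (u − 1) ∈ (3)` and `x` is prime to `3`, so `u ≡ 1 (mod 3)`
  have hxu : x * ((u : 𝓞 K) - 1) ∈ Ideal.span {(3 : 𝓞 K)} := by
    rw [show x * ((u : 𝓞 K) - 1) = (x * u - 1) - (x - 1) by ring]
    exact Ideal.sub_mem _ hy1 hx1
  obtain ⟨a, ha, b, hb, hab⟩ := Submodule.mem_sup.mp
    ((Ideal.isCoprime_iff_sup_eq.mp hx).symm ▸ Submodule.mem_top :
      (1 : 𝓞 K) ∈ Ideal.span {x} ⊔ Ideal.span {(3 : 𝓞 K)})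
  obtain ⟨r, rfl⟩ := Ideal.mem_span_singleton'.mp ha
  have hu1 : (u : 𝓞 K) - 1 ∈ Ideal.span {(3 : 𝓞 K)} := by
    rw [show (u : 𝓞 K) - 1 = r * (x * ((u : 𝓞 K) - 1)) + ((u : 𝓞 K) - 1) * b by
      linear_combination (-((u : 𝓞 K) - 1)) * hab]
    exact Ideal.add_mem _ (Ideal.mul_mem_left _ _ hxu) (Ideal.mul_mem_left _ _ hb)
  rw [units_eq_one_of_sub_one_mem_span_three hζ u hu1, Units.val_one, mul_one]

include hζ in
/-- **`J(χ_𝔭, χ_𝔭) = −ϖ_𝔭` in `ℤ[ω]`** — Ireland–Rosen Ch. 9 §4 Lemma 1 "`J(χ_π, χ_π) = π` for `π`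
primary" on the nose: if `ϖ` generates `𝔭 ∤ 3` and `ϖ ≡ 1 (mod 3)` (THE primary generator in the
normalisation `≡ 1`; Ireland–Rosen's primary `π ≡ 2 (mod 3)` is `−ϖ`), then `J(χ_𝔭, χ_𝔭) = −ϖ`,
because `J(χ_𝔭, χ_𝔭)` generates `𝔭` (`span_cubicJacobiSum_eq`) and is `≡ −1 (mod 3)`
(`cubicJacobiSum_add_one_mem_span_three`). [cite: IrelandRosen1990, Ch. 9 §4 Lemma 1] -/
theorem cubicJacobiSum_eq_neg_of_span_eq (𝔭 : HeightOneSpectrum (𝓞 K)) (h3 : (3 : 𝓞 K) ∉ 𝔭.asIdeal)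
    {ϖ : 𝓞 K} (hϖ : Ideal.span {ϖ} = 𝔭.asIdeal) (hϖ1 : ϖ - 1 ∈ Ideal.span {(3 : 𝓞 K)}) :
    cubicJacobiSum hζ 𝔭 h3 = -ϖ := by
  set J := cubicJacobiSum hζ 𝔭 h3 with hJdef
  have hle : ¬ Ideal.span {(3 : 𝓞 K)} ≤ 𝔭.asIdeal := fun h ↦ h3 (h (Ideal.subset_span rfl))
  have hspanJ : Ideal.span {-J} = 𝔭.asIdeal := by
    rw [Ideal.span_singleton_neg, hJdef, span_cubicJacobiSum_eq hζ 𝔭 h3]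
  have hJ1 : -J - 1 ∈ Ideal.span {(3 : 𝓞 K)} := by
    have h := (Ideal.span {(3 : 𝓞 K)}).neg_mem (cubicJacobiSum_add_one_mem_span_three hζ 𝔭 h3)
    rwa [show -(cubicJacobiSum hζ 𝔭 h3 + 1) = -J - 1 by rw [hJdef]; ring] at h
  have hcop : IsCoprime (Ideal.span {-J}) (Ideal.span {(3 : 𝓞 K)}) := by
    rw [hspanJ, Ideal.isCoprime_iff_sup_eq]
    by_contra hne
    exact hle (le_sup_right.trans (𝔭.isMaximal.eq_of_le hne le_sup_left).ge)
  have h := eq_of_span_eq_of_sub_one_mem_span_three hζ (hspanJ.trans hϖ.symm) hcop hJ1 hϖ1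
  linear_combination -h

include hζ in
/-- **Existence of the primary generator** of a prime `𝔭 ∤ 3` of the principal ideal domain `ℤ[ω]`:
some `ϖ ≡ 1 (mod 3)` generates `𝔭` (`exists_units_mul_sub_one_mem_span_three` applied to any
generator). [cite: IrelandRosen1990, Ch. 9 §3 Prop. 9.3.5] -/
theorem exists_span_eq_and_sub_one_mem_span_three [IsPrincipalIdealRing (𝓞 K)]
    (𝔭 : HeightOneSpectrum (𝓞 K)) (h3 : (3 : 𝓞 K) ∉ 𝔭.asIdeal) :
    ∃ ϖ : 𝓞 K, Ideal.span {ϖ} = 𝔭.asIdeal ∧ ϖ - 1 ∈ Ideal.span {(3 : 𝓞 K)} := by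
  set g := Submodule.IsPrincipal.generator 𝔭.asIdeal with hg
  have hspan : Ideal.span {g} = 𝔭.asIdeal := Ideal.span_singleton_generator _
  have hle : ¬ Ideal.span {(3 : 𝓞 K)} ≤ 𝔭.asIdeal := fun h ↦ h3 (h (Ideal.subset_span rfl))
  have hcop : IsCoprime (Ideal.span {g}) (Ideal.span {(3 : 𝓞 K)}) := by
    rw [hspan, Ideal.isCoprime_iff_sup_eq]
    by_contra hne
    exact hle (le_sup_right.trans (𝔭.isMaximal.eq_of_le hne le_sup_left).ge)
  obtain ⟨u, hu⟩ := exists_units_mul_sub_one_mem_span_three hζ g hcop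
  refine ⟨u * g, ?_, hu⟩
  rw [← hspan, mul_comm]
  exact Ideal.span_singleton_eq_span_singleton.mpr ⟨u⁻¹, Units.mul_inv_cancel_right g u⟩

include hζ in
/-- Hence, in `ℤ[ω]`, **`−J(χ_𝔭, χ_𝔭)` is the primary generator of `𝔭`**: it generates `𝔭` and is
`≡ 1 (mod 3)`. [cite: IrelandRosen1990, Ch. 9 §4 Lemma 1] -/
theorem span_neg_cubicJacobiSum_eq_and_sub_one_mem (𝔭 : HeightOneSpectrum (𝓞 K))
    (h3 : (3 : 𝓞 K) ∉ 𝔭.asIdeal) :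
    Ideal.span {-cubicJacobiSum hζ 𝔭 h3} = 𝔭.asIdeal ∧
      -cubicJacobiSum hζ 𝔭 h3 - 1 ∈ Ideal.span {(3 : 𝓞 K)} := by
  refine ⟨by rw [Ideal.span_singleton_neg, span_cubicJacobiSum_eq hζ 𝔭 h3], ?_⟩
  have h := (Ideal.span {(3 : 𝓞 K)}).neg_mem (cubicJacobiSum_add_one_mem_span_three hζ 𝔭 h3)
  rwa [show -(cubicJacobiSum hζ 𝔭 h3 + 1) = -cubicJacobiSum hζ 𝔭 h3 - 1 by ring] at h

end Eisenstein

end Literature.NumberTheory.GaloisRepresentations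

end
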